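import Literature.AlgebraicGeometry.Motives.VerticalLimitsOfLines
import HarnessLib

/-!
# Specialisations of a linear subspace of the generic fibre, read in the fibre over any base point

`Motives/VerticalLimitsOfLines` (`ProjFamily.exists_line_of_vertical`) shows that a point `w` of
`ℙᴺ ×ₖ B` over a CLOSED point `b` of the base, lying in the closure of a linear subspace `V₊(μ)` of
the generic fibre `ℙᴺ_{k(B)}`, satisfies the reduced equations: `pr₁ w ∈ V₊(L̄) ⊆ ℙᴺ_k`. This file
proves the same statement over an ARBITRARY point `b ∈ B` (in particular the generic point of a
curve on a surface `B`), read in the fibre `ℙᴺ_{κ(b)}`: the *fibre slice*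
`σ_b : ℙᴺ_{κ(b)} ⟶ ℙᴺ ×ₖ B` (reduction `Γ(B, U)[x] → κ(b)[x]` followed by the open piece
`ℙᴺ_{Γ(B,U)} = ℙᴺ × U ⊆ ℙᴺ ×ₖ B`) is a base change of `Spec κ(b) → B`, its image is the fibre
`pr₂⁻¹(b)`, and for `w = σ_b(p)` in the closure of `V₊(μ)` the reductions `L♭ᵢ ∈ κ(b)[x]` of integral
forms spanning `(μ)` lie in the homogeneous prime of `p` (`ProjFamily.exists_fibre_forms_of_vertical`).
The integral forms (coordinates in `𝒪_{B,b}`, in the `k(B)`-span of the `μ_l`, with independent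
reductions) are an INPUT, as in a chart of the Grassmannian; over a discrete valuation ring they
always exist (Smith normal form). This is the form of "limits of lines are lines" needed for the
product trick over a two-dimensional base (vertical components over curves of the base).
Everything is proved; no definitions.

## References

* [TianZong2014] Z. Tian, H. R. Zong, *One-cycles on rationally connected varieties*, Compositio
  Math. 150 (2014), proofs of Prop. 3.1 and Prop. 7.2.
* [Fulton1998] W. Fulton, *Intersection Theory*, §10.1 (specialisation), §1.7 (fibre squares).
* [Liu2002] Q. Liu, *Algebraic Geometry and Arithmetic Curves*, Ex. 3.1.10 (`ℙᴺ_A = ℙᴺ × Spec A`).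
-/

noncomputable section

open CategoryTheory CategoryTheory.Limits AlgebraicGeometry MonoidalCategory MvPolynomial
  TopologicalSpace Order

universe u

namespace Literature.AlgebraicGeometry.Motives

attribute [local instance] MvPolynomial.gradedAlgebra MvPolynomial.algebraMvPolynomial
  Literature.AlgebraicGeometry.Motives.ProjBaseChange.algebraBase
  UniversalHyperplaneSection.sectionsAlgebra

namespace ProjFamily

open ProjBaseChangeRing ProjectiveSpaceCells
open UniversalHyperplaneSection (sectionsAlgebra fromSpec_comp_hom algebraMap_sections)

variable {k : Type u} [Field k] (N : ℕ) (B : SchemeOver k) {U : B.left.Opens} (hU : IsAffineOpen U)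
  (x : U) [Algebra Γ(B.left, U) (IsLocalRing.ResidueField (B.left.presheaf.stalk (x : B.left)))]
  [IsScalarTower Γ(B.left, U) (B.left.presheaf.stalk (x : B.left)) (IsLocalRing.ResidueField (B.left.presheaf.stalk (x : B.left)))]

/-! ### The fibre slice `ℙᴺ_{κ(b)} ⟶ ℙᴺ ×ₖ B` -/

/-- `Spec κ(b) → Spec A → U ⊆ B` is the canonical `Spec κ(b) → B` (for the `A`-algebra structure
on `κ(b)` through the stalk, `A = Γ(B, U)`). [folklore] -/
theorem specMap_algebraMap_residueField_comp_fromSpec :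
    Spec.map (CommRingCat.ofHom (algebraMap Γ(B.left, U) (IsLocalRing.ResidueField (B.left.presheaf.stalk (x : B.left))))) ≫
      hU.fromSpec = B.left.fromSpecResidueField (x : B.left) := by
  have halg : algebraMap Γ(B.left, U) (IsLocalRing.ResidueField (B.left.presheaf.stalk (x : B.left))) =
      (IsLocalRing.residue (B.left.presheaf.stalk (x : B.left))).comp
        (algebraMap Γ(B.left, U) (B.left.presheaf.stalk (x : B.left))) :=
    IsScalarTower.algebraMap_eq Γ(B.left, U) (B.left.presheaf.stalk (x : B.left))
      (IsLocalRing.ResidueField (B.left.presheaf.stalk (x : B.left)))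
  have hof : CommRingCat.ofHom (algebraMap Γ(B.left, U)
      (IsLocalRing.ResidueField (B.left.presheaf.stalk (x : B.left)))) =
        B.left.presheaf.germ U x x.2 ≫ B.left.residue (x : B.left) := by
    rw [halg]; rfl
  calc Spec.map (CommRingCat.ofHom (algebraMap Γ(B.left, U)
        (IsLocalRing.ResidueField (B.left.presheaf.stalk (x : B.left))))) ≫ hU.fromSpec
      = (Spec.map (B.left.residue (x : B.left)) ≫ Spec.map (B.left.presheaf.germ U x x.2)) ≫
          hU.fromSpec := by
        rw [hof]
        exact congrArg (· ≫ hU.fromSpec) (Spec.map_comp _ _)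
    _ = B.left.fromSpecResidueField (x : B.left) := by
        rw [Category.assoc, Scheme.fromSpecResidueField, ← hU.fromSpecStalk_eq_fromSpecStalk x.2,
          IsAffineOpen.fromSpecStalk]

/-- **The fibre slice is a base change of `Spec κ(b) → B`**: the square
`σ_b : ℙᴺ_{κ(b)} → ℙᴺ ×ₖ B`, `ℙᴺ_{κ(b)} → Spec κ(b)`, `pr₂`, `Spec κ(b) → B` is cartesian (paste
`ℙᴺ_{κ(b)} = ℙᴺ_A ×_A κ(b)` with the open piece `ℙᴺ_A = ℙᴺ × U`). [cite: Liu2002, Ex. 3.1.10] -/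
theorem isPullback_fibreSlice :
    IsPullback
      (Proj.map (mapGraded Γ(B.left, U) (IsLocalRing.ResidueField (B.left.presheaf.stalk (x : B.left))) (Fin (N + 1)))
        (irrelevant_le_map Γ(B.left, U) (IsLocalRing.ResidueField (B.left.presheaf.stalk (x : B.left))) (Fin (N + 1))) ≫
        openPiece N B hU)
      (projToSpec (Fin (N + 1)) (IsLocalRing.ResidueField (B.left.presheaf.stalk (x : B.left))))
      (CartesianMonoidalCategory.snd (projectiveSpace N k) B).left
      (B.left.fromSpecResidueField (x : B.left)) := by
  have h := (isPullback_projMap' Γ(B.left, U) (IsLocalRing.ResidueField (B.left.presheaf.stalk (x : B.left))) (n := N)).paste_horiz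
    (isPullback_openPiece N B hU)
  rw [specMap_algebraMap_residueField_comp_fromSpec B hU x] at h
  exact h

/-- The image of the fibre slice is the fibre `pr₂⁻¹(b)`. [folklore] -/
theorem range_fibreSlice :
    Set.range (Proj.map (mapGraded Γ(B.left, U) (IsLocalRing.ResidueField (B.left.presheaf.stalk (x : B.left))) (Fin (N + 1)))
        (irrelevant_le_map Γ(B.left, U) (IsLocalRing.ResidueField (B.left.presheaf.stalk (x : B.left))) (Fin (N + 1))) ≫
        openPiece N B hU).base =
      (CartesianMonoidalCategory.snd (projectiveSpace N k) B).left.base ⁻¹' {(x : B.left)} := by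
  rw [Literature.AlgebraicGeometry.Limits.range_fst_of_isPullback (isPullback_fibreSlice N B hU x)]
  ext w
  simp only [Set.mem_preimage, Set.mem_singleton_iff, Set.mem_range]
  constructor
  · rintro ⟨s, hs⟩
    rw [← hs]
    exact Scheme.fromSpecResidueField_apply (x : B.left) s
  · intro h
    exact ⟨IsLocalRing.closedPoint _, (Scheme.fromSpecResidueField_apply (x : B.left) _).trans h.symm⟩

omit [IsScalarTower Γ(B.left, U) (B.left.presheaf.stalk (x : B.left))
  (IsLocalRing.ResidueField (B.left.presheaf.stalk (x : B.left)))] in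
/-- The fibre slice followed by `pr₁` is `ℙᴺ_{κ(b)} → ℙᴺ_k`. [folklore] -/
theorem fibreSlice_fst [Algebra k (IsLocalRing.ResidueField (B.left.presheaf.stalk (x : B.left)))]
    [IsScalarTower k Γ(B.left, U) (IsLocalRing.ResidueField (B.left.presheaf.stalk (x : B.left)))] :
    (Proj.map (mapGraded Γ(B.left, U) (IsLocalRing.ResidueField (B.left.presheaf.stalk (x : B.left))) (Fin (N + 1)))
        (irrelevant_le_map Γ(B.left, U) (IsLocalRing.ResidueField (B.left.presheaf.stalk (x : B.left))) (Fin (N + 1))) ≫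
        openPiece N B hU) ≫ (CartesianMonoidalCategory.fst (projectiveSpace N k) B).left =
      Proj.map (mapGraded k (IsLocalRing.ResidueField (B.left.presheaf.stalk (x : B.left))) (Fin (N + 1)))
        (irrelevant_le_map k (IsLocalRing.ResidueField (B.left.presheaf.stalk (x : B.left))) (Fin (N + 1))) := by
  rw [Category.assoc, openPiece_fst]
  have hcomp : Proj.map (mapGraded k (IsLocalRing.ResidueField (B.left.presheaf.stalk (x : B.left))) (Fin (N + 1)))
      (irrelevant_le_map k (IsLocalRing.ResidueField (B.left.presheaf.stalk (x : B.left))) (Fin (N + 1))) =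
      Proj.map ((mapGraded Γ(B.left, U) (IsLocalRing.ResidueField (B.left.presheaf.stalk (x : B.left))) (Fin (N + 1))).comp
        (mapGraded k Γ(B.left, U) (Fin (N + 1))))
        (HomogeneousIdeal.irrelevant_le_map_comp (irrelevant_le_map k Γ(B.left, U) (Fin (N + 1)))
          (irrelevant_le_map Γ(B.left, U) (IsLocalRing.ResidueField (B.left.presheaf.stalk (x : B.left))) (Fin (N + 1)))) := by
    congr 1
    ext p : 1
    change MvPolynomial.map (algebraMap k (IsLocalRing.ResidueField (B.left.presheaf.stalk (x : B.left)))) p =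
      MvPolynomial.map (algebraMap Γ(B.left, U) (IsLocalRing.ResidueField (B.left.presheaf.stalk (x : B.left))))
        (MvPolynomial.map (algebraMap k Γ(B.left, U)) p)
    rw [MvPolynomial.map_map, ← IsScalarTower.algebraMap_eq]
  rw [hcomp]
  exact (Proj.map_comp _ _ _ _).symm

/-! ### Reduced equations in the fibre -/

attribute [local instance] functionFieldAlgebra

/-- **Specialisations of a linear subspace of the generic fibre satisfy the reduced equations, in
the fibre over any base point — core form.** As `exists_fibre_forms_of_vertical` below, with the
hypothesis on the integral vectors `wvᵢ` stated directly as: the linear form with coefficients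
`wvᵢ` (read in `K`) lies in the homogeneous prime of `λ'` (no auxiliary forms `μ`). [cite: TianZong2014, proofs of Prop. 3.1 and Prop. 7.2] [cite: Fulton1998, §10.1] -/
theorem exists_fibre_forms_of_vertical_of_mem [IsIntegral B.left] {r : ℕ}
    (ι : Proj (homogeneousSubmodule (Fin (N + 1)) B.left.functionField) ⟶
      ((projectiveSpace N k) ⊗ B).left)
    (h₁ : ι ≫ (CartesianMonoidalCategory.fst (projectiveSpace N k) B).left =
      Proj.map (mapGraded k B.left.functionField (Fin (N + 1)))
        (irrelevant_le_map k B.left.functionField (Fin (N + 1))))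
    (h₂ : ι ≫ (CartesianMonoidalCategory.snd (projectiveSpace N k) B).left =
      projToSpec (Fin (N + 1)) B.left.functionField ≫ B.left.fromSpecStalk (genericPoint B.left))
    (lam : ↥(Proj (homogeneousSubmodule (Fin (N + 1)) B.left.functionField)))
    {w : ↥((projectiveSpace N k) ⊗ B).left} (hw : w ∈ closure {ι.base lam})
    (hwb : (CartesianMonoidalCategory.snd (projectiveSpace N k) B).left.base w = (x : B.left))
    (wv : Fin r → Fin (N + 1) → B.left.presheaf.stalk (x : B.left))
    (hwmem : ∀ i, lin (Literature.LinearAlgebra.toFrac (B.left.presheaf.stalk (x : B.left))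
      B.left.functionField (wv i)) ∈
      ProjectiveSpectrum.asHomogeneousIdeal (𝒜 := homogeneousSubmodule (Fin (N + 1)) B.left.functionField) lam)
    (hliO : LinearIndependent (IsLocalRing.ResidueField (B.left.presheaf.stalk (x : B.left)))
      fun i j => IsLocalRing.residue (B.left.presheaf.stalk (x : B.left)) (wv i j)) :
    ∃ p : ↥(Proj (homogeneousSubmodule (Fin (N + 1)) (IsLocalRing.ResidueField (B.left.presheaf.stalk (x : B.left))))),
      (Proj.map (mapGraded Γ(B.left, U) (IsLocalRing.ResidueField (B.left.presheaf.stalk (x : B.left))) (Fin (N + 1)))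
        (irrelevant_le_map Γ(B.left, U) (IsLocalRing.ResidueField (B.left.presheaf.stalk (x : B.left))) (Fin (N + 1))) ≫
        openPiece N B hU).base p = w ∧
      LinearIndependent (IsLocalRing.ResidueField (B.left.presheaf.stalk (x : B.left)))
        (fun i => lin fun j => IsLocalRing.residue (B.left.presheaf.stalk (x : B.left)) (wv i j)) ∧
      ∀ i, lin (fun j => IsLocalRing.residue (B.left.presheaf.stalk (x : B.left)) (wv i j)) ∈
        ProjectiveSpectrum.asHomogeneousIdeal
          (𝒜 := homogeneousSubmodule (Fin (N + 1)) (IsLocalRing.ResidueField (B.left.presheaf.stalk (x : B.left)))) p := by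
  classical
  haveI : Nonempty U := ⟨x⟩
  haveI := isScalarTower_sections_functionField B U
  haveI hloc : IsLocalization.AtPrime (B.left.presheaf.stalk (x : B.left)) (hU.primeIdealOf x).asIdeal :=
    hU.isLocalization_stalk x
  haveI : IsScalarTower Γ(B.left, U) (B.left.presheaf.stalk (x : B.left)) B.left.functionField :=
    functionField_isScalarTower B.left U x
  -- the point `p` of the fibre with `σ_b p = w`
  obtain ⟨p, hp⟩ : w ∈ Set.range (Proj.map (mapGraded Γ(B.left, U) (IsLocalRing.ResidueField (B.left.presheaf.stalk (x : B.left)))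
      (Fin (N + 1))) (irrelevant_le_map Γ(B.left, U) (IsLocalRing.ResidueField (B.left.presheaf.stalk (x : B.left))) (Fin (N + 1))) ≫
        openPiece N B hU).base := by
    rw [range_fibreSlice N B hU x]
    exact hwb
  -- Step 2: clear denominators: a common `t ∉ 𝔭_b` with `t • wv i j` integral over `A`
  obtain ⟨t, ht⟩ := IsLocalization.exist_integer_multiples (hU.primeIdealOf x).asIdeal.primeCompl
    (Finset.univ : Finset (Fin r × Fin (N + 1))) (fun q => wv q.1 q.2)
  choose! y hy using ht
  have hy' : ∀ i j, algebraMap Γ(B.left, U) (B.left.presheaf.stalk (x : B.left)) (y (i, j)) =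
      algebraMap Γ(B.left, U) (B.left.presheaf.stalk (x : B.left)) t * wv i j := fun i j => by
    rw [hy (i, j) (Finset.mem_univ _), Algebra.smul_def]
  let μA : Fin r → MvPolynomial (Fin (N + 1)) Γ(B.left, U) := fun i => linR fun j => y (i, j)
  -- Step 3: the forms over `A` vanish at `λ'` after scalar extension to `K`
  have hμAK : ∀ i, MvPolynomial.map (algebraMap Γ(B.left, U) B.left.functionField) (μA i) ∈
      ProjectiveSpectrum.asHomogeneousIdeal (𝒜 := homogeneousSubmodule (Fin (N + 1)) B.left.functionField) lam := by
    intro i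
    rw [map_linR]
    have hcoef : (fun j => algebraMap Γ(B.left, U) B.left.functionField (y (i, j))) =
        fun j => algebraMap Γ(B.left, U) B.left.functionField t *
          Literature.LinearAlgebra.toFrac (B.left.presheaf.stalk (x : B.left)) B.left.functionField (wv i) j := by
      funext j
      rw [Literature.LinearAlgebra.toFrac_apply, IsScalarTower.algebraMap_apply Γ(B.left, U)
        (B.left.presheaf.stalk (x : B.left)) B.left.functionField, hy' i j, map_mul,
        ← IsScalarTower.algebraMap_apply]
    rw [hcoef]
    have hsmul : lin (fun j => algebraMap Γ(B.left, U) B.left.functionField t *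
        Literature.LinearAlgebra.toFrac (B.left.presheaf.stalk (x : B.left)) B.left.functionField (wv i) j) =
        C (algebraMap Γ(B.left, U) B.left.functionField t) *
          lin (Literature.LinearAlgebra.toFrac (B.left.presheaf.stalk (x : B.left)) B.left.functionField (wv i)) := by
      simp only [lin, Finset.mul_sum, MvPolynomial.smul_eq_C_mul, map_mul, mul_assoc]
    rw [hsmul]
    exact Ideal.mul_mem_left _ _ (hwmem i)
  -- Step 4: specialise to the fibre over `b`, through the open piece `ℙᴺ_A`
  have hw' : w ∈ closure {(openPiece N B hU).base ((Proj.map (mapGraded Γ(B.left, U)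
      B.left.functionField (Fin (N + 1)))
      (irrelevant_le_map Γ(B.left, U) B.left.functionField (Fin (N + 1)))).base lam)} := by
    have hι := eq_map_comp_openPiece N B hU ι h₁ (h₂.trans (by
      rw [fromSpecStalk_genericPoint_eq B hU]))
    rw [hι, Scheme.Hom.comp_base, TopCat.coe_comp, Function.comp_apply] at hw
    exact hw
  have hcl : (Proj.map (mapGraded Γ(B.left, U) (IsLocalRing.ResidueField (B.left.presheaf.stalk (x : B.left))) (Fin (N + 1)))
      (irrelevant_le_map Γ(B.left, U) (IsLocalRing.ResidueField (B.left.presheaf.stalk (x : B.left))) (Fin (N + 1)))).base p ∈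
      closure {(Proj.map (mapGraded Γ(B.left, U) B.left.functionField (Fin (N + 1)))
        (irrelevant_le_map Γ(B.left, U) B.left.functionField (Fin (N + 1)))).base lam} := by
    rw [(openPiece N B hU).isOpenEmbedding.isInducing.closure_eq_preimage_closure_image,
      Set.image_singleton, Set.mem_preimage]
    change ((Proj.map (mapGraded Γ(B.left, U) (IsLocalRing.ResidueField (B.left.presheaf.stalk (x : B.left))) (Fin (N + 1)))
      (irrelevant_le_map Γ(B.left, U) (IsLocalRing.ResidueField (B.left.presheaf.stalk (x : B.left))) (Fin (N + 1))) ≫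
        openPiece N B hU).base p) ∈ _
    rw [hp]
    exact hw'
  have hvan : ∀ i, MvPolynomial.map (algebraMap Γ(B.left, U) (IsLocalRing.ResidueField (B.left.presheaf.stalk (x : B.left)))) (μA i) ∈
      ProjectiveSpectrum.asHomogeneousIdeal
        (𝒜 := homogeneousSubmodule (Fin (N + 1)) (IsLocalRing.ResidueField (B.left.presheaf.stalk (x : B.left)))) p :=
    fun i => ProjectiveSpectrum.map_mem_of_mem_closure lam p hcl (hμAK i)
  -- Step 5: the reduced forms: `r(μA i) = r(t) • L♭ i` with `r(t) ≠ 0`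
  have htk : algebraMap Γ(B.left, U) (IsLocalRing.ResidueField (B.left.presheaf.stalk (x : B.left))) t ≠ 0 := by
    intro h0
    rw [IsScalarTower.algebraMap_apply Γ(B.left, U) (B.left.presheaf.stalk (x : B.left))
      (IsLocalRing.ResidueField (B.left.presheaf.stalk (x : B.left)))] at h0
    have hmem : algebraMap Γ(B.left, U) (B.left.presheaf.stalk (x : B.left)) t ∈
        IsLocalRing.maximalIdeal (B.left.presheaf.stalk (x : B.left)) :=
      (IsLocalRing.residue_eq_zero_iff _).1 h0
    exact t.2 ((IsLocalization.AtPrime.to_map_mem_maximal_iff (B.left.presheaf.stalk (x : B.left))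
      (hU.primeIdealOf x).asIdeal (t : Γ(B.left, U))).1 hmem)
  have hred : ∀ i, MvPolynomial.map (algebraMap Γ(B.left, U) (IsLocalRing.ResidueField (B.left.presheaf.stalk (x : B.left)))) (μA i) =
      C (algebraMap Γ(B.left, U) (IsLocalRing.ResidueField (B.left.presheaf.stalk (x : B.left))) t) *
        lin (fun j => IsLocalRing.residue (B.left.presheaf.stalk (x : B.left)) (wv i j)) := by
    intro i
    rw [map_linR]
    have hcoef : (fun j => algebraMap Γ(B.left, U) (IsLocalRing.ResidueField (B.left.presheaf.stalk (x : B.left))) (y (i, j))) =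
        fun j => algebraMap Γ(B.left, U) (IsLocalRing.ResidueField (B.left.presheaf.stalk (x : B.left))) t *
          IsLocalRing.residue (B.left.presheaf.stalk (x : B.left)) (wv i j) := by
      funext j
      rw [IsScalarTower.algebraMap_apply Γ(B.left, U) (B.left.presheaf.stalk (x : B.left))
        (IsLocalRing.ResidueField (B.left.presheaf.stalk (x : B.left))), hy' i j, map_mul, ← IsScalarTower.algebraMap_apply]
      rfl
    rw [hcoef]
    simp only [lin, Finset.mul_sum, MvPolynomial.smul_eq_C_mul, map_mul, mul_assoc]
  have hLli : LinearIndependent (IsLocalRing.ResidueField (B.left.presheaf.stalk (x : B.left)))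
      (fun i => lin fun j => IsLocalRing.residue (B.left.presheaf.stalk (x : B.left)) (wv i j)) :=
    hliO.map' (linMap (k := IsLocalRing.ResidueField (B.left.presheaf.stalk (x : B.left))) (N := N)) ker_linMap
  refine ⟨p, hp, hLli, fun i => ?_⟩
  -- `L♭ i = r(t)⁻¹ • r(μA i) ∈ 𝔭 p`
  have hmem := hvan i
  rw [hred i] at hmem
  have h := Ideal.mul_mem_left _ (C (algebraMap Γ(B.left, U) (IsLocalRing.ResidueField (B.left.presheaf.stalk (x : B.left))) t)⁻¹) hmem
  rw [← mul_assoc, ← C_mul, inv_mul_cancel₀ htk, C_1, one_mul] at h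
  exact h

/-- **Specialisations of a linear subspace of the generic fibre satisfy the reduced equations, in
the fibre over any base point.** Let `B` be an integral `k`-scheme, `K = k(B)`,
`ι : ℙᴺ_K → ℙᴺ ×ₖ B` the generic fibre, `λ'` a point of `ℙᴺ_K` at which the linear forms
`μ₁, …, μ_r` over `K` vanish, `b ∈ U = Spec A ⊆ B` any point, and `wv₁, …, wv_r` vectors with
coordinates in `𝒪_{B,b}` lying in the `K`-span of the coefficient vectors of the `μ_l` whose
reductions modulo `𝔪_b` are linearly independent over `κ(b)`. Then every point `w ∈ ℙᴺ ×ₖ B` over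
`b` in the closure of `ι(λ')` is `σ_b(p)` for a point `p` of `ℙᴺ_{κ(b)}` at which the `r` reduced
linear forms `L♭ᵢ = Σ_j (wvᵢⱼ mod 𝔪_b) x_j` — linearly independent over `κ(b)` — vanish.
[cite: TianZong2014, proofs of Prop. 3.1 and Prop. 7.2] [cite: Fulton1998, §10.1] -/
theorem exists_fibre_forms_of_vertical [IsIntegral B.left] {r : ℕ}
    (ι : Proj (homogeneousSubmodule (Fin (N + 1)) B.left.functionField) ⟶
      ((projectiveSpace N k) ⊗ B).left)
    (h₁ : ι ≫ (CartesianMonoidalCategory.fst (projectiveSpace N k) B).left =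
      Proj.map (mapGraded k B.left.functionField (Fin (N + 1)))
        (irrelevant_le_map k B.left.functionField (Fin (N + 1))))
    (h₂ : ι ≫ (CartesianMonoidalCategory.snd (projectiveSpace N k) B).left =
      projToSpec (Fin (N + 1)) B.left.functionField ≫ B.left.fromSpecStalk (genericPoint B.left))
    (μ : Fin r → MvPolynomial (Fin (N + 1)) B.left.functionField)
    (hμhom : ∀ l, (μ l).IsHomogeneous 1)
    (lam : ↥(Proj (homogeneousSubmodule (Fin (N + 1)) B.left.functionField)))
    (hlam : ∀ l, μ l ∈ ProjectiveSpectrum.asHomogeneousIdeal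
      (𝒜 := homogeneousSubmodule (Fin (N + 1)) B.left.functionField) lam)
    {w : ↥((projectiveSpace N k) ⊗ B).left} (hw : w ∈ closure {ι.base lam})
    (hwb : (CartesianMonoidalCategory.snd (projectiveSpace N k) B).left.base w = (x : B.left))
    (wv : Fin r → Fin (N + 1) → B.left.presheaf.stalk (x : B.left))
    (hwv : ∀ i, Literature.LinearAlgebra.toFrac (B.left.presheaf.stalk (x : B.left))
      B.left.functionField (wv i) ∈
      Submodule.span B.left.functionField
        (Set.range fun (l : Fin r) (j : Fin (N + 1)) => coeff (Finsupp.single j 1) (μ l)))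
    (hliO : LinearIndependent (IsLocalRing.ResidueField (B.left.presheaf.stalk (x : B.left)))
      fun i j => IsLocalRing.residue (B.left.presheaf.stalk (x : B.left)) (wv i j)) :
    ∃ p : ↥(Proj (homogeneousSubmodule (Fin (N + 1)) (IsLocalRing.ResidueField (B.left.presheaf.stalk (x : B.left))))),
      (Proj.map (mapGraded Γ(B.left, U) (IsLocalRing.ResidueField (B.left.presheaf.stalk (x : B.left))) (Fin (N + 1)))
        (irrelevant_le_map Γ(B.left, U) (IsLocalRing.ResidueField (B.left.presheaf.stalk (x : B.left))) (Fin (N + 1))) ≫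
        openPiece N B hU).base p = w ∧
      LinearIndependent (IsLocalRing.ResidueField (B.left.presheaf.stalk (x : B.left)))
        (fun i => lin fun j => IsLocalRing.residue (B.left.presheaf.stalk (x : B.left)) (wv i j)) ∧
      ∀ i, lin (fun j => IsLocalRing.residue (B.left.presheaf.stalk (x : B.left)) (wv i j)) ∈
        ProjectiveSpectrum.asHomogeneousIdeal
          (𝒜 := homogeneousSubmodule (Fin (N + 1)) (IsLocalRing.ResidueField (B.left.presheaf.stalk (x : B.left)))) p := by
  classical
  -- Step 1: the coefficient vectors of the `μ l`
  let vμ : Fin r → Fin (N + 1) → B.left.functionField := fun l j => coeff (Finsupp.single j 1) (μ l)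
  have hvμ : ∀ l, lin (vμ l) = μ l := fun l => (eq_lin_of_isHomogeneous_one (hμhom l)).symm
  let W : Submodule B.left.functionField (Fin (N + 1) → B.left.functionField) :=
    Submodule.span B.left.functionField (Set.range vμ)
  -- each `wv i` gives a linear form over `K` in the homogeneous prime of `λ'`
  have hwmem : ∀ i, lin (Literature.LinearAlgebra.toFrac (B.left.presheaf.stalk (x : B.left))
      B.left.functionField (wv i)) ∈
      ProjectiveSpectrum.asHomogeneousIdeal (𝒜 := homogeneousSubmodule (Fin (N + 1)) B.left.functionField) lam := by
    intro i
    have hin : Literature.LinearAlgebra.toFrac (B.left.presheaf.stalk (x : B.left)) B.left.functionField (wv i) ∈ W :=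
      hwv i
    let I : Submodule B.left.functionField (MvPolynomial (Fin (N + 1)) B.left.functionField) :=
      ((ProjectiveSpectrum.asHomogeneousIdeal
        (𝒜 := homogeneousSubmodule (Fin (N + 1)) B.left.functionField) lam).toIdeal).restrictScalars
          B.left.functionField
    have hle : W ≤ I.comap (linMap (k := B.left.functionField) (N := N)) := by
      refine Submodule.span_le.mpr ?_
      rintro _ ⟨l, rfl⟩
      change lin (vμ l) ∈ (ProjectiveSpectrum.asHomogeneousIdeal
        (𝒜 := homogeneousSubmodule (Fin (N + 1)) B.left.functionField) lam).toIdeal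
      rw [hvμ]
      exact hlam l
    exact hle hin
  exact exists_fibre_forms_of_vertical_of_mem N B hU x ι h₁ h₂ lam hw hwb wv hwmem hliO

end ProjFamily

end Literature.AlgebraicGeometry.Motives

end
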